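import Literature.NumberTheory.EllipticCurves.ModularSymbolsEichlerShimuraHoldsProofs
import HarnessLib

/-!
# A real cusp cocycle on `Γ₀(N)` is the real part of the periods of a cusp form

Theorems (and three auxiliary definitions `etaSL`, `etaM`, `etaMap`; no named facts). Fourth
brick of the proof of Riemann's period relations for `X₀(N)` in Petersson form (hypothesis `hRB`
of `PastenSpectralDegreeHomologyProofs.lean`). A **real cusp cocycle** (`IsCuspCocycle`) is a
function `ι : SL(2, ℤ) → ℝ` with `ι(k) = 0` when `k∞ = ∞`, `ι(kTᵐ) = ι(k)`, `ι(-k) = ι(k)` and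
`ι(γk) = ι(k) + ι(γ)` for `γ ∈ Γ₀(N)` — "the value of a `Γ₀(N)`-quasi-periodic function at the
cusp `k∞` minus its value at `∞`"; the potential `U` of the dual form of a closed geodesic gives
one (`DualFormPotentialProofs`). The theorem:

* **`RealCocycle.exists_cuspForm_re_cuspSymbol_eq`** — for every real cusp cocycle `ι` there is
  `u ∈ S₂(Γ₀(N))` with `re {∞, γ∞}_u = ι(γ)` for all `γ ∈ Γ₀(N)`

(the real form of the surjectivity in the Eichler–Shimura isomorphism, Shimura Thm. 8.4). Proof,
entirely inside the tree's Manin-symbol algebra (`ModularSymbolsManin`): the `η`-M-symbols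
`[k]_ι = ι(k) - ι(kS)` satisfy the two- and three-term relations (`etaSL_add_etaSL_mul_S`,
`etaSL_three_term`), so `η : ℚ^X → ℝ` kills the relation module; Manin's continued-fraction chain
`c_k` has `Ψ(c_k) = {∞, k∞}`, `δ(c_k) = [k∞] - [∞]` and `η(c_k) = ι(k)` (`exists_chain₂`); on the
cycles `U = ker δ` the kernel of `Ψ` is the relation module by the dimension squeeze
`dim U - dim Rel ≤ 2g ≤ dim_ℚ ℚH ≤ dim Ψ(U)` (`finrank_relModule_ge`,
`two_mul_finrank_cuspForm_two_le_finrank_span_periodHomology`, the genus formula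
`twelve_mul_finrank_cuspForm_two_gamma0_holds`), so `η` descends to `Ψ(U) ⊇ H`
(`etaMap_eq_zero_of`); it extends `ℝ`-linearly to `S₂^∨` along an `ℝ`-basis spanning `H` over `ℤ`
(`periodHomology_eq_span_basis_holds`; `exists_dual_functional`), and every real functional on
`S₂^∨` is `φ ↦ re φ(u)` (`exists_cuspForm_re_apply_eq`, dimension count).

## References

* [ShimuraIATAF1971] G. Shimura, *Introduction to the Arithmetic Theory of Automorphic Functions*
  (1971), §8.2, Thm. 8.4 (`S₂ ≅ H¹_par(Γ, ℝ)`).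
* [CremonaAlgorithms1997] J. E. Cremona, *Algorithms for Modular Elliptic Curves*, 2nd ed. (1997),
  §2.1 Thm. 2.1.2, §2.2–2.3 (M-symbols, Manin's trick).
* [DiamondShurman2005] F. Diamond, J. Shurman, *A First Course in Modular Forms*, §6.1.
-/

noncomputable section

open scoped MatrixGroups ModularForm
open CongruenceSubgroup Matrix.SpecialLinearGroup ModularGroup Module LinearMap

namespace Literature.NumberTheory.EllipticCurves.ModularForms

namespace RealCocycle

open scoped Classical

variable {N : ℕ}

/-! ### Elements of `SL(2, ℤ)` fixing `∞` -/

/-- An element of `SL(2, ℤ)` with lower-left entry `0` is `±Tⁿ`. [folklore] -/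
theorem eq_T_zpow_or_neg (g : SL(2, ℤ)) (hg : g 1 0 = 0) : ∃ n : ℤ, g = T ^ n ∨ g = -T ^ n := by
  have hdet := Matrix.SpecialLinearGroup.det_coe g
  rw [Matrix.det_fin_two, hg, mul_zero, sub_zero] at hdet
  rcases Int.eq_one_or_neg_one_of_mul_eq_one' hdet with ⟨ha, hd⟩ | ⟨ha, hd⟩
  · refine ⟨g 0 1, Or.inl ?_⟩
    ext i j
    fin_cases i <;> fin_cases j <;> simp [coe_T_zpow, ha, hd, hg]
  · refine ⟨-g 0 1, Or.inr ?_⟩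
    ext i j
    fin_cases i <;> fin_cases j <;> simp [coe_T_zpow, ha, hd, hg]

/-! ### Cusp cocycles -/

/-- A **real cusp cocycle** on `Γ₀(N)`: a function `ι : SL(2, ℤ) → ℝ` ("`ι(k)` = value at the cusp
`k∞` minus value at `∞`") vanishing at `∞`, invariant under `k ↦ kTᵐ` and `k ↦ -k`, and
`Γ₀(N)`-quasi-invariant: `ι(gk) = ι(k) + ι(g)`. The real parts of `k ↦ {∞, k∞}_h` are examples;
the theorem of this file (`exists_cuspForm_re_cuspSymbol_eq`) is that they are the only ones. [folklore] -/
structure IsCuspCocycle (N : ℕ) (ι : SL(2, ℤ) → ℝ) : Prop where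
  apply_eq_zero : ∀ k : SL(2, ℤ), k 1 0 = 0 → ι k = 0
  mul_T_zpow : ∀ (k : SL(2, ℤ)) (m : ℤ), ι (k * T ^ m) = ι k
  neg : ∀ k : SL(2, ℤ), ι (-k) = ι k
  mul_of_mem : ∀ {g : SL(2, ℤ)}, g ∈ Gamma0 N → ∀ k : SL(2, ℤ), ι (g * k) = ι k + ι g

variable {ι : SL(2, ℤ) → ℝ}

/-- `ι` depends only on the first column up to sign (i.e. on the cusp `k∞`). [folklore] -/
theorem apply_eq_of_apply_eq (hι : IsCuspCocycle N ι) {k k' : SL(2, ℤ)} (ε : ℤ) (hε : ε = 1 ∨ ε = -1)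
    (h0 : k' 0 0 = ε * k 0 0) (h1 : k' 1 0 = ε * k 1 0) : ι k' = ι k := by
  -- `k⁻¹ k'` fixes `∞`
  have h10 : (k⁻¹ * k') 1 0 = 0 := by
    rw [Matrix.SpecialLinearGroup.SL2_inv_expl]
    simp [Matrix.mul_apply, Fin.sum_univ_two, h0, h1]
    rcases hε with rfl | rfl <;> ring
  have e : k' = k * (k⁻¹ * k') := (mul_inv_cancel_left k k').symm
  obtain ⟨n, hn | hn⟩ := eq_T_zpow_or_neg (k⁻¹ * k') h10
  · rw [e, hn, hι.mul_T_zpow]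
  · rw [e, hn, mul_neg, hι.neg, hι.mul_T_zpow]

/-- `ι(kS S) = ι(k)`: `kSS = -k`. [folklore] -/
theorem apply_mul_S_mul_S (hι : IsCuspCocycle N ι) (k : SL(2, ℤ)) : ι (k * S * S) = ι k := by
  have : k * S * S = -k := by
    rw [mul_assoc]
    ext i j
    fin_cases i <;> fin_cases j <;> simp [coe_S, Matrix.mul_apply, Fin.sum_univ_two]
  rw [this, hι.neg]

/-! ### The `η`-M-symbols `[k]_ι = ι(k) - ι(kS)` and their relations -/

/-- The **M-symbol of the cocycle**: `[k]_ι = ι(k) - ι(kS)` ("value at `k∞` minus value at `k0`"). [folklore] -/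
def etaSL (ι : SL(2, ℤ) → ℝ) (k : SL(2, ℤ)) : ℝ := ι k - ι (k * S)

/-- `[gk]_ι = [k]_ι` for `g ∈ Γ₀(N)`. [folklore] -/
theorem etaSL_mul_of_mem (hι : IsCuspCocycle N ι) {g : SL(2, ℤ)} (hg : g ∈ Gamma0 N) (k : SL(2, ℤ)) :
    etaSL ι (g * k) = etaSL ι k := by
  simp only [etaSL, mul_assoc, hι.mul_of_mem hg]
  ring

/-- The two-term relation `[k] + [kS] = 0`. [folklore] -/
theorem etaSL_add_etaSL_mul_S (hι : IsCuspCocycle N ι) (k : SL(2, ℤ)) :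
    etaSL ι k + etaSL ι (k * S) = 0 := by
  simp only [etaSL, apply_mul_S_mul_S hι]
  ring

/-- The three-term relation `[k] + [kTS] + [k(TS)²] = 0`. [folklore] -/
theorem etaSL_three_term (hι : IsCuspCocycle N ι) (k : SL(2, ℤ)) :
    etaSL ι k + etaSL ι (k * (T * S)) + etaSL ι (k * (T * S) ^ 2) = 0 := by
  have h1 : ι (k * (T * S) * S) = ι k :=
    apply_eq_of_apply_eq hι (-1) (Or.inr rfl)
      (by simp [coe_T, coe_S, Matrix.mul_apply, Fin.sum_univ_two])
      (by simp [coe_T, coe_S, Matrix.mul_apply, Fin.sum_univ_two])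
  have h2 : ι (k * (T * S) ^ 2) = ι (k * S) :=
    apply_eq_of_apply_eq hι 1 (Or.inl rfl)
      (by simp [coe_T, coe_S, Matrix.mul_apply, Fin.sum_univ_two, pow_two])
      (by simp [coe_T, coe_S, Matrix.mul_apply, Fin.sum_univ_two, pow_two])
  have h3 : ι (k * (T * S) ^ 2 * S) = ι (k * (T * S)) :=
    apply_eq_of_apply_eq hι (-1) (Or.inr rfl)
      (by simp [coe_T, coe_S, Matrix.mul_apply, Fin.sum_univ_two, pow_two]; ring)
      (by simp [coe_T, coe_S, Matrix.mul_apply, Fin.sum_univ_two, pow_two]; ring)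
  simp only [etaSL, h1, h2, h3]
  ring

variable [NeZero N]

/-- The M-symbol of a coset `gΓ₀(N) ↦ [g⁻¹]_ι` (through the representative `q.out`). [folklore] -/
def etaM (ι : SL(2, ℤ) → ℝ) (q : Gamma0Coset N) : ℝ := etaSL ι (Quotient.out q)⁻¹

omit [NeZero N] in
/-- `etaM` on a representative. [folklore] -/
theorem etaM_mk (hι : IsCuspCocycle N ι) (g : SL(2, ℤ)) : etaM ι (g : Gamma0Coset N) = etaSL ι g⁻¹ := by
  unfold etaM
  set g' : SL(2, ℤ) := Quotient.out (g : Gamma0Coset N) with hg'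
  have hmem : g⁻¹ * g' ∈ Gamma0 N := by
    rw [← QuotientGroup.eq, hg', QuotientGroup.out_eq']
  have : g'⁻¹ = (g⁻¹ * g')⁻¹ * g⁻¹ := by group
  rw [this, etaSL_mul_of_mem hι (inv_mem hmem)]

omit [NeZero N] in
/-- Two-term relation on cosets. [folklore] -/
theorem etaM_add_etaM_S_inv_smul (hι : IsCuspCocycle N ι) (q : Gamma0Coset N) :
    etaM ι q + etaM ι (S⁻¹ • q) = 0 := by
  induction q using QuotientGroup.induction_on with
  | H g =>
    rw [MulAction.Quotient.smul_mk, smul_eq_mul, etaM_mk hι, etaM_mk hι, mul_inv_rev, inv_inv]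
    exact etaSL_add_etaSL_mul_S hι g⁻¹

omit [NeZero N] in
/-- Three-term relation on cosets. [folklore] -/
theorem etaM_three_term (hι : IsCuspCocycle N ι) (q : Gamma0Coset N) :
    etaM ι q + etaM ι ((T * S)⁻¹ • q) + etaM ι (((T * S)⁻¹) ^ 2 • q) = 0 := by
  induction q using QuotientGroup.induction_on with
  | H g =>
    rw [MulAction.Quotient.smul_mk, MulAction.Quotient.smul_mk, smul_eq_mul, smul_eq_mul, etaM_mk hι,
      etaM_mk hι, etaM_mk hι, mul_inv_rev, inv_inv, mul_inv_rev, inv_pow, inv_inv]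
    exact etaSL_three_term hι g⁻¹

/-- The **`η`-M-symbol map** `ℚ^X → ℝ`, `c ↦ ∑_q c_q [q]_ι` (`ℚ`-linear). [folklore] -/
def etaMap (ι : SL(2, ℤ) → ℝ) : (Gamma0Coset N → ℚ) →ₗ[ℚ] ℝ :=
  Fintype.linearCombination ℚ (etaM (N := N) ι)

/-- `η(a e_q) = a [q]_ι`. [folklore] -/
@[simp] theorem etaMap_single (q : Gamma0Coset N) (a : ℚ) :
    etaMap (N := N) ι (Pi.single q a) = a • etaM ι q := by
  simp [etaMap, Fintype.linearCombination_apply_single]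

/-- The two-term relations are relations for `η`. [folklore] -/
theorem etaMap_comp_relTwo (hι : IsCuspCocycle N ι) : etaMap (N := N) ι ∘ₗ relTwo N = 0 := by
  refine (Pi.basisFun ℚ (Gamma0Coset N)).ext fun q ↦ ?_
  rw [LinearMap.comp_apply, Pi.basisFun_apply, relTwo_single, map_add, etaMap_single,
    etaMap_single, one_smul, one_smul, LinearMap.zero_apply]
  exact etaM_add_etaM_S_inv_smul hι q

/-- The three-term relations are relations for `η`. [folklore] -/
theorem etaMap_comp_relThree (hι : IsCuspCocycle N ι) : etaMap (N := N) ι ∘ₗ relThree N = 0 := by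
  refine (Pi.basisFun ℚ (Gamma0Coset N)).ext fun q ↦ ?_
  rw [LinearMap.comp_apply, Pi.basisFun_apply, relThree_single, map_add, map_add,
    etaMap_single, etaMap_single, etaMap_single, one_smul, one_smul, one_smul, LinearMap.zero_apply]
  exact etaM_three_term hι q

/-- `Rel ⊆ ker η`. [folklore] -/
theorem relModule_le_ker_etaMap (hι : IsCuspCocycle N ι) : relModule N ≤ LinearMap.ker (etaMap (N := N) ι) := by
  refine sup_le ?_ ?_ <;> rw [LinearMap.range_le_ker_iff]
  · exact etaMap_comp_relTwo hι
  · exact etaMap_comp_relThree hι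

/-! ### Manin's trick for the pair `(Ψ, η)` -/

/-- **Manin's trick, simultaneously for the period symbols and for `η`**: for every `k ∈ SL(2, ℤ)`
there is an integral chain `c` with `Ψ(c) = {∞, k∞}`, `δ(c) = [k∞] - [∞]` and `η(c) = ι(k)`
(the same continued-fraction chain as `exists_chain`). [cite: CremonaAlgorithms1997, §2.3] -/
theorem exists_chain₂ (hι : IsCuspCocycle N ι) (k : SL(2, ℤ)) :
    ∃ c : Gamma0Coset N → ℚ, msymbolMap N c = inftyFunctional k ∧
      bdryMap N c = Pi.single (cuspOrbitOf N k) 1 - Pi.single (cuspOrbitOf N 1) 1 ∧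
      etaMap ι c = ι k := by
  suffices H : ∀ n : ℕ, ∀ k : SL(2, ℤ), (k 1 0).natAbs = n →
      ∃ c : Gamma0Coset N → ℚ, msymbolMap N c = inftyFunctional k ∧
        bdryMap N c = Pi.single (cuspOrbitOf N k) 1 - Pi.single (cuspOrbitOf N 1) 1 ∧
        etaMap ι c = ι k from H _ k rfl
  intro n
  induction n using Nat.strong_induction_on with
  | _ n ih =>
    intro k hk
    by_cases hz : k 1 0 = 0
    · refine ⟨0, ?_, ?_, ?_⟩
      · rw [map_zero]; ext h; simp [inftySymbol, hz]
      · rw [map_zero, cuspOrbitOf_of_apply_eq_zero hz, sub_self]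
      · rw [map_zero, hι.apply_eq_zero k hz]
    · -- Euclidean step
      set m : ℤ := -(k 1 1 / k 1 0) with hm
      set k' : SL(2, ℤ) := k * T ^ m * S with hk'
      have hk'10 : k' 1 0 = k 1 1 % k 1 0 := by
        simp only [hk', coe_mul, coe_S, coe_T_zpow, Matrix.mul_apply, Fin.sum_univ_two]
        simp [hm, Int.emod_def]
        ring
      have hlt : (k' 1 0).natAbs < n := by
        rw [← hk, hk'10]
        have h0 := Int.emod_nonneg (k 1 1) hz
        have h1 := Int.emod_lt_abs (k 1 1) hz
        zify
        rw [abs_of_nonneg h0]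
        exact h1
      obtain ⟨c', hc'm, hc'b, hc'e⟩ := ih _ hlt k' rfl
      set q₀ : Gamma0Coset N := (((k * T ^ m)⁻¹ : SL(2, ℤ)) : Gamma0Coset N)
      refine ⟨c' + Pi.single q₀ 1, ?_, ?_, ?_⟩
      · rw [map_add, hc'm, msymbolMap_single, one_smul, msymbol_mk, inv_inv]
        ext h
        simp only [LinearMap.add_apply, inftyFunctional_apply, msymbolFunctional_apply, msymbolSL,
          hk', inftySymbol_mul_T_zpow]
        ring
      · rw [map_add, hc'b, bdryMap_single, one_smul, bdryVec, MulAction.Quotient.smul_mk, smul_eq_mul,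
          cuspInfty_mk, cuspInfty_mk, inv_inv, mul_inv_rev, inv_inv, inv_inv, cuspOrbitOf_mul_T_zpow]
        have : cuspOrbitOf N (k * T ^ m * S) = cuspOrbitOf N k' := by rw [hk']
        rw [this]
        abel
      · rw [map_add, hc'e, etaMap_single, one_smul, etaM_mk hι, inv_inv, etaSL, hk', hι.mul_T_zpow]
        ring

/-! ### `η` factors through `Ψ` on the cycles (dimension squeeze) -/

/-- **A cycle with zero period symbol has zero `η`.** On `U = ker δ`, the kernel of the M-symbol
map `Ψ` is exactly the relation module `Rel` (Manin's count `dim U - dim Rel ≤ 2g`,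
`finrank_relModule_ge`, against `dim Ψ(U) ≥ dim_ℚ ℚH ≥ 2 dim S₂ = 2g`,
`two_mul_finrank_cuspForm_two_le_finrank_span_periodHomology`, and the genus formula
`twelve_mul_finrank_cuspForm_two_gamma0_holds`), and `Rel ⊆ ker η`. This is the statement that the
`η`-symbols, which satisfy Manin's relations, define a functional on `H₁(X₀(N), ℚ) = Z/B`
(Manin 1972, Thm. 1.9; Cremona 1997, Thm. 2.1.2). [cite: CremonaAlgorithms1997, §2.1 Thm. 2.1.2] -/
theorem etaMap_eq_zero_of (hι : IsCuspCocycle N ι) {x : Gamma0Coset N → ℚ}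
    (hxδ : bdryMap N x = 0) (hxΨ : msymbolMap N x = 0) : etaMap ι x = 0 := by
  set U : Submodule ℚ (Gamma0Coset N → ℚ) := LinearMap.ker (bdryMap N) with hU
  set g : U →ₗ[ℚ] Module.Dual ℂ (CuspForm (Gamma0 N) 2) := (msymbolMap N).domRestrict U with hg
  set Rel' : Submodule ℚ U := (relModule N).comap U.subtype with hRel'
  have hker : Rel' ≤ LinearMap.ker g := by
    intro y hy
    rw [LinearMap.mem_ker, hg, LinearMap.domRestrict_apply]
    exact relModule_le_ker_msymbolMap hy
  -- the numbers
  have hUδ : finrank ℚ (range (bdryMap N)) + finrank ℚ U = Fintype.card (Gamma0Coset N) := by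
    rw [LinearMap.finrank_range_add_finrank_ker, finrank_fintype_fun_eq_card]
  have hε := card_cuspOrbits_le_finrank_range_bdryMap_add_one (N := N)
  have hgr : finrank ℚ (range g) + finrank ℚ (LinearMap.ker g) = finrank ℚ U :=
    LinearMap.finrank_range_add_finrank_ker g
  have hRel'eq : finrank ℚ Rel' = finrank ℚ (relModule N) :=
    LinearEquiv.finrank_eq (Submodule.comapSubtypeEquivOfLe relModule_le_ker_bdryMap)
  have hRel := finrank_relModule_ge (N := N)
  have hrange : range g = U.map (msymbolMap N) := LinearMap.range_domRestrict _ _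
  have hH : finrank ℚ (Submodule.span ℚ (periodHomology N : Set (Module.Dual ℂ (CuspForm (Gamma0 N) 2))))
      ≤ finrank ℚ (range g) := by
    rw [hrange]
    exact Submodule.finrank_mono (Submodule.span_le.mpr periodHomology_le_map_ker)
  have h2 := two_mul_finrank_cuspForm_two_le_finrank_span_periodHomology N
  have hgenus := twelve_mul_finrank_cuspForm_two_gamma0_holds N (Gamma0_is_congruence N)
  rw [adjoinNegI_gamma0, ellipticPointCount_two_gamma0_eq_card, ellipticPointCount_three_gamma0_eq_card] at hgenus
  have hμ : (Gamma0 N).index = Fintype.card (Gamma0Coset N) := by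
    rw [Subgroup.index, Nat.card_eq_fintype_card]
  have hε₂ : Nat.card {q : SL(2, ℤ) ⧸ Gamma0 N // S • q = q} =
      (Finset.univ.filter fun q : Gamma0Coset N ↦ S • q = q).card := by
    rw [Nat.card_eq_fintype_card, Fintype.card_subtype]
  have hε₃ : Nat.card {q : SL(2, ℤ) ⧸ Gamma0 N // (T * S) • q = q} =
      (Finset.univ.filter fun q : Gamma0Coset N ↦ (T * S) • q = q).card := by
    rw [Nat.card_eq_fintype_card, Fintype.card_subtype]
  rw [hμ, hε₂, hε₃] at hgenus
  -- squeeze: `dim ker g ≤ dim Rel'`, hence `ker g = Rel'`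
  have hle : finrank ℚ (LinearMap.ker g) ≤ finrank ℚ Rel' := by
    rw [hRel'eq]
    omega
  have heq : Rel' = LinearMap.ker g := Submodule.eq_of_le_of_finrank_le hker hle
  -- apply to `x`
  have hxU : x ∈ U := hxδ
  have hxker : (⟨x, hxU⟩ : U) ∈ LinearMap.ker g := by
    rw [LinearMap.mem_ker, hg, LinearMap.domRestrict_apply]
    exact hxΨ
  rw [← heq, hRel', Submodule.mem_comap, Submodule.subtype_apply] at hxker
  exact relModule_le_ker_etaMap hι hxker

/-! ### A real functional on `S₂(Γ₀(N))^∨` with `Λ({∞, γ∞}) = ι(γ)` -/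

/-- **The cocycle is a real-linear functional of the period functional**: there is an
`ℝ`-linear `Λ : S₂(Γ₀(N))^∨ → ℝ` with `Λ(h ↦ {∞, γ∞}_h) = ι(γ)` for all `γ ∈ Γ₀(N)`. (`η`
descends to the `ℚ`-span `Ψ(U) ⊇ H` of the period homology by `etaMap_eq_zero_of`, takes the
value `ι(γ)` on `{∞, γ∞} = Ψ(c_γ)` by Manin's trick `exists_chain₂`, and extends `ℝ`-linearly
along an `ℝ`-basis of `S₂^∨` spanning `H` over `ℤ`, `periodHomology_eq_span_basis_holds`.) [folklore] -/
theorem exists_dual_functional (hι : IsCuspCocycle N ι) :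
    ∃ Λ : Module.Dual ℂ (CuspForm (Gamma0 N) 2) →ₗ[ℝ] ℝ, ∀ γ : Gamma0 N, Λ (periodFunctional N γ) = ι γ := by
  set U : Submodule ℚ (Gamma0Coset N → ℚ) := LinearMap.ker (bdryMap N) with hU
  set g : U →ₗ[ℚ] Module.Dual ℂ (CuspForm (Gamma0 N) 2) := (msymbolMap N).domRestrict U with hg
  set g₂ : U →ₗ[ℚ] ℝ := (etaMap ι).domRestrict U with hg₂
  have hkk : LinearMap.ker g ≤ LinearMap.ker g₂ := by
    intro y hy
    rw [LinearMap.mem_ker, hg, LinearMap.domRestrict_apply] at hy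
    rw [LinearMap.mem_ker, hg₂, LinearMap.domRestrict_apply]
    exact etaMap_eq_zero_of hι y.2 hy
  -- `λ : range g → ℝ` with `λ (g y) = g₂ y`
  set lam : LinearMap.range g →ₗ[ℚ] ℝ := ((LinearMap.ker g).liftQ g₂ hkk) ∘ₗ g.quotKerEquivRange.symm.toLinearMap
    with hlam
  have hlam_apply : ∀ y : U, lam ⟨g y, LinearMap.mem_range_self g y⟩ = g₂ y := by
    intro y
    rw [hlam, LinearMap.comp_apply, LinearEquiv.coe_toLinearMap, LinearMap.quotKerEquivRange_symm_apply_image,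
      Submodule.mkQ_apply, Submodule.liftQ_apply]
  have hrange : LinearMap.range g = U.map (msymbolMap N) := LinearMap.range_domRestrict _ _
  have hHM : (periodHomology N : Set (Module.Dual ℂ (CuspForm (Gamma0 N) 2))) ⊆ LinearMap.range g := by
    rw [hrange]; exact periodHomology_le_map_ker
  -- the basis
  obtain ⟨n, b, hb⟩ := periodHomology_eq_span_basis_holds N
  have hbH : ∀ i, b i ∈ periodHomology N := by
    intro i
    have : b i ∈ (Submodule.span ℤ (Set.range b) : Set _) := Submodule.subset_span ⟨i, rfl⟩
    rw [← hb] at this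
    exact this
  set Λ : Module.Dual ℂ (CuspForm (Gamma0 N) 2) →ₗ[ℝ] ℝ := b.constr ℝ fun i ↦ lam ⟨b i, hHM (hbH i)⟩ with hΛ
  -- `Λ = lam` on `H`
  have hagree : ∀ y (hy : y ∈ Submodule.span ℤ (Set.range b)), Λ y = lam ⟨y, hHM (by rw [hb]; exact hy)⟩ := by
    intro y hy
    induction hy using Submodule.span_induction with
    | mem x hx =>
      obtain ⟨i, rfl⟩ := hx
      rw [hΛ, Basis.constr_basis]
    | zero =>
      rw [map_zero]
      have : (⟨0, hHM (by rw [hb]; exact Submodule.zero_mem _)⟩ : LinearMap.range g) = 0 := rfl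
      rw [this, map_zero]
    | add x y hx hy ihx ihy =>
      rw [map_add, ihx, ihy, ← map_add]
      rfl
    | smul a x hx ih =>
      rw [map_zsmul, ih, ← map_zsmul]
      rfl
  refine ⟨Λ, fun γ ↦ ?_⟩
  have hγH : periodFunctional N γ ∈ Submodule.span ℤ (Set.range b) := by
    have : periodFunctional N γ ∈ (periodHomology N : Set _) := AddSubgroup.subset_closure ⟨γ, rfl⟩
    rw [hb] at this
    exact this
  rw [hagree _ hγH]
  -- Manin's trick for `γ`
  obtain ⟨c, hcm, hcb, hce⟩ := exists_chain₂ hι (γ : SL(2, ℤ))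
  have hcU : c ∈ U := by
    rw [hU, LinearMap.mem_ker, hcb, sub_eq_zero]
    congr 1
    simpa using cuspOrbitOf_mul_of_mem γ.2 (1 : SL(2, ℤ))
  have hgc : g ⟨c, hcU⟩ = periodFunctional N γ := by
    rw [hg, LinearMap.domRestrict_apply, hcm, periodFunctional_eq_inftyFunctional]
  have e : (⟨periodFunctional N γ, hHM (by rw [hb]; exact hγH)⟩ : LinearMap.range g) =
      ⟨g ⟨c, hcU⟩, LinearMap.mem_range_self g _⟩ := Subtype.ext hgc.symm
  rw [e, hlam_apply, hg₂, LinearMap.domRestrict_apply]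
  exact hce

/-! ### Real parts of values: a Riesz-type representation -/

omit [NeZero N] in
/-- **Every real-linear functional on `S₂(Γ₀(N))^∨` is `φ ↦ re φ(u)` for a unique cusp form `u`**
(the `ℝ`-linear map `u ↦ (φ ↦ re φ(u))` is injective — `re (iφ)(u) = -im φ(u)` — between real
vector spaces of the same dimension `2 dim_ℂ S₂(Γ₀(N))`). [folklore] -/
theorem exists_cuspForm_re_apply_eq [NeZero N] (Λ : Module.Dual ℂ (CuspForm (Gamma0 N) 2) →ₗ[ℝ] ℝ) :
    ∃ u : CuspForm (Gamma0 N) 2, ∀ φ : Module.Dual ℂ (CuspForm (Gamma0 N) 2), (φ u).re = Λ φ := by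
  set ev : CuspForm (Gamma0 N) 2 →ₗ[ℝ] (Module.Dual ℂ (CuspForm (Gamma0 N) 2) →ₗ[ℝ] ℝ) :=
    { toFun := fun u ↦
        { toFun := fun φ ↦ (φ u).re
          map_add' := fun φ ψ ↦ by simp
          map_smul' := fun r φ ↦ by simp }
      map_add' := fun u v ↦ by ext φ; simp
      map_smul' := fun r u ↦ by
        ext φ
        simp only [LinearMap.coe_mk, AddHom.coe_mk, RingHom.id_apply, LinearMap.smul_apply, smul_eq_mul]
        rw [← Complex.coe_smul, map_smul, smul_eq_mul, Complex.re_ofReal_mul] } with hev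
  have hinj : Function.Injective ev := by
    rw [← LinearMap.ker_eq_bot, LinearMap.ker_eq_bot']
    intro u hu
    rw [← Module.forall_dual_apply_eq_zero_iff ℂ u]
    intro φ
    have h1 : (φ u).re = 0 := by
      have := congrArg (fun L : Module.Dual ℂ (CuspForm (Gamma0 N) 2) →ₗ[ℝ] ℝ ↦ L φ) hu
      simpa [hev] using this
    have h2 : (φ u).im = 0 := by
      have := congrArg (fun L : Module.Dual ℂ (CuspForm (Gamma0 N) 2) →ₗ[ℝ] ℝ ↦ L (Complex.I • φ)) hu
      simp [hev] at this
      exact this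
    exact Complex.ext h1 h2
  have hdim : finrank ℝ (CuspForm (Gamma0 N) 2) =
      finrank ℝ (Module.Dual ℂ (CuspForm (Gamma0 N) 2) →ₗ[ℝ] ℝ) := by
    rw [Module.finrank_linearMap, Module.finrank_self, mul_one, finrank_real_of_complex,
      finrank_real_of_complex, Subspace.dual_finrank_eq]
  have hsurj := (LinearMap.injective_iff_surjective_of_finrank_eq_finrank hdim).mp hinj
  obtain ⟨u, hu⟩ := hsurj Λ
  exact ⟨u, fun φ ↦ by rw [← hu]; rfl⟩

/-- **A real cusp cocycle on `Γ₀(N)` is the real part of the periods of a cusp form**: if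
`ι : SL(2, ℤ) → ℝ` vanishes at `∞`, is invariant under `k ↦ kTᵐ`, `k ↦ -k` and satisfies
`ι(γk) = ι(k) + ι(γ)` for `γ ∈ Γ₀(N)`, then there is `u ∈ S₂(Γ₀(N))` with `re {∞, γ∞}_u = ι(γ)`
for all `γ ∈ Γ₀(N)`. This is the real form of the surjectivity half of the Eichler–Shimura
isomorphism `S₂(Γ₀(N)) ≅ H¹_par(Γ₀(N), ℝ)` (Shimura 1971, Thm. 8.4), obtained here from the
lattice property of the period homology (`periodHomology_eq_span_basis_holds`, Diamond–Shurman
§6.1) and Manin's presentation (Cremona 1997, Thm. 2.1.2). [cite: ShimuraIATAF1971, Thm. 8.4] -/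
theorem exists_cuspForm_re_cuspSymbol_eq (hι : IsCuspCocycle N ι) :
    ∃ u : CuspForm (Gamma0 N) 2, ∀ γ : Gamma0 N, (cuspSymbol u γ).re = ι γ := by
  obtain ⟨Λ, hΛ⟩ := exists_dual_functional hι
  obtain ⟨u, hu⟩ := exists_cuspForm_re_apply_eq Λ
  exact ⟨u, fun γ ↦ by rw [← periodFunctional_apply, hu, hΛ]⟩

end RealCocycle

end Literature.NumberTheory.EllipticCurves.ModularForms

end
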